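import Literature.AnabelianGeometry.SemiGraphs.QuasiTemperoidsThmA4Unique
import Literature.AnabelianGeometry.SemiGraphs.QuasiTemperoidsCharts
import Literature.AnabelianGeometry.SemiGraphs.TemperoidsHomProofs
import Literature.AnabelianGeometry.SemiGraphs.TemperoidsCountablyConnectedTransport
import HarnessLib

/-!
# Semi-graphs of anabelioids, Appendix: Theorem A.4 (chart route) — assembly from the engine

Mochizuki, *Semi-graphs of anabelioids*, Publ. RIMS **42** (2006), Appendix, Theorem A.4 (manuscript
pp. 82–86) [cite: MochizukiSemiAnbd2006, Thm A.4 pp.82-86].  PROOF-ONLY assembly step (L3-lead μ3-1/ν3-1,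
rows C-S2/S3) of the chart-route proof of the EXISTENCE half of Thm. A.4 in the Galois-countable case:
GIVEN the engine's conclusion — for every functor `F : T₂[A₂] ⥤ T₁[A₁]` between the model
quasi-temperoids `Over' Aᵢ ⊆ B^temp(Πᵢ)` (`Π₂` tempered and second countable, `A₁` connected)
preserving finite limits, countable colimits and nondegenerate objects there is a continuous
`φ : Π₁ → Π₂` with `F ⋙ ι₁ ≅ ι₂ ⋙ B^temp(φ)` (rows C-S1a/S1b/S1c, the port of the Prop. 3.2 engine) — as
the HYPOTHESIS `hE`, this file transports it along charts `Tᵢ ≌ B^temp(Πᵢ)` of connected temperoids and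
the induced `Tᵢ[Aᵢ] ≌ B^temp(Πᵢ)[Aᵢ′]` (`overPrimeEquivOfEquiv`) to the conclusion of Thm. A.4:
`thmA4_exists_of_engine` (a morphism of temperoids `ψ := B^temp(φ)` with `φ^* ⋙ λ₁^* ≅ λ₂^* ⋙ ψ^*`;
`ψ^*` preserves finite limits and countable colimits by `ResIsTemperoidHom_holds`) and, with the
uniqueness clause `thmA4_unique` (p414142), the full `ThmA4`-shaped statement for Galois-countable charts
`thmA4_of_engine`.  HONEST FRAMING: these theorems are CONDITIONAL on `hE` until rows C-S1b/C-S1c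
land; the hypothesis is spelled out verbatim (no `Prop` definition), and the restricted theorem does NOT
close the typed `ThmA4` (no Galois-countability there).  Nothing takes a side on [IUTchIII] Cor. 3.12.
-/

namespace Literature.AnabelianGeometry.SemiGraphs

namespace ThmA4Chart

open CategoryTheory CategoryTheory.Limits Topology
open Literature.AlgebraicGeometry.Frobenioids (IsConnectedObj IsNonemptyObj)

universe v₁ v₂ u u₁ u₂

/-! ### Nondegenerate objects along equivalences -/

section Transport

variable {C : Type u₁} [Category.{v₁} C] {D : Type u₂} [Category.{v₂} D]

/-- Nondegeneracy (Def. A.1 (ii)) is preserved by an equivalence of categories.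
[cite: MochizukiSemiAnbd2006, Def A.1(ii) p.79] -/
theorem isNondegenerateObj_functor_obj (e : C ≌ D) {X : C} (hX : IsNondegenerateObj X) :
    IsNondegenerateObj (e.functor.obj X) := by
  intro B hB
  obtain ⟨C', hC', ⟨k⟩, ⟨l⟩⟩ := hX (e.inverse.obj B)
    (TemperoidTransport.isConnectedObj_functor_obj e.symm hB)
  exact ⟨e.functor.obj C', TemperoidTransport.isConnectedObj_functor_obj e hC',
    ⟨e.functor.map k ≫ e.counitIso.hom.app B⟩, ⟨e.functor.map l⟩⟩

end Transport

/-! ### Assembly -/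

/-- **Thm. A.4, existence half, Galois-countable case — ASSEMBLY from the chart-route engine.** Given the
engine conclusion `hE` (for functors between the model quasi-temperoids `B^temp(Πᵢ)[Aᵢ]`), every morphism
of connected quasi-temperoids `φ : T₁[A₁] → T₂[A₂]` whose `Tᵢ` admit charts `Tᵢ ≌ B^temp(Πᵢ)` with
`Πᵢ` second countable is the restriction of a morphism of temperoids `ψ : T₁ → T₂`:
`φ^* ⋙ λ₁^* ≅ λ₂^* ⋙ ψ^*`. [cite: MochizukiSemiAnbd2006, Thm A.4 pp.82-86] -/
theorem thmA4_exists_of_engine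
    (hE : ∀ {G₁ : Type u} [Group G₁] [TopologicalSpace G₁] [IsTopologicalGroup G₁]
      [SecondCountableTopology G₁]
      {G₂ : Type u} [Group G₂] [TopologicalSpace G₂] [IsTopologicalGroup G₂]
      [SecondCountableTopology G₂] (_ : IsTempered G₁) (_ : IsTempered G₂)
      {A₁ : BTemp G₁} (_ : IsConnectedObj A₁) {A₂ : BTemp G₂} (_ : A₂.obj.V)
      (F : Over' A₂ ⥤ Over' A₁) (_ : PreservesFiniteLimits F)
      (_ : ∀ (J : Type) [SmallCategory J] [CountableCategory J], PreservesColimitsOfShape J F)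
      (_ : ∀ X : Over' A₂, IsNondegenerateObj X → IsNondegenerateObj (F.obj X)),
      ∃ φ : G₁ →ₜ* G₂, Nonempty (F ⋙ (admitsHomTo A₁).ι ≅ (admitsHomTo A₂).ι ⋙ BTemp.res φ))
    {T₁ : Type u₁} [Category.{v₁} T₁] {T₂ : Type u₂} [Category.{v₂} T₂]
    (c₁ : ConnectedTemperoidChart.{v₁, u, u₁} T₁) (c₂ : ConnectedTemperoidChart.{v₂, u, u₂} T₂)
    [SecondCountableTopology c₁.G] [SecondCountableTopology c₂.G]
    {A₁ : T₁} {A₂ : T₂} (hA₁ : IsConnectedObj A₁) (hA₂ : IsConnectedObj A₂)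
    (φ : TemperoidHom (Over' A₁) (Over' A₂)) (hφ : φ.PreservesNondegenerate) :
    ∃ ψ : TemperoidHom T₁ T₂,
      Nonempty (φ.pullback ⋙ (admitsHomTo A₁).ι ≅ (admitsHomTo A₂).ι ⋙ ψ.pullback) := by
  -- charts and base points
  let e₁ := c₁.equiv
  let e₂ := c₂.equiv
  let B₁ : BTemp c₁.G := e₁.functor.obj A₁
  let B₂ : BTemp c₂.G := e₂.functor.obj A₂
  have hB₁ : IsConnectedObj B₁ := TemperoidTransport.isConnectedObj_functor_obj e₁ hA₁
  have hB₂ : IsConnectedObj B₂ := TemperoidTransport.isConnectedObj_functor_obj e₂ hA₂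
  obtain ⟨b₂⟩ := (BTemp.isNonemptyObj_iff B₂).mp hB₂.1
  let o₁ : Over' A₁ ≌ Over' B₁ := overPrimeEquivOfEquiv e₁ A₁
  let o₂ : Over' A₂ ≌ Over' B₂ := overPrimeEquivOfEquiv e₂ A₂
  -- the functor between the model quasi-temperoids
  let F : Over' B₂ ⥤ Over' B₁ := o₂.inverse ⋙ φ.pullback ⋙ o₁.functor
  haveI := φ.preservesFiniteLimits
  have hlim : PreservesFiniteLimits F := by
    haveI : PreservesFiniteLimits (φ.pullback ⋙ o₁.functor) := comp_preservesFiniteLimits _ _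
    exact comp_preservesFiniteLimits _ _
  have hcolim : ∀ (J : Type) [SmallCategory J] [CountableCategory J], PreservesColimitsOfShape J F := by
    intro J _ _
    haveI : PreservesColimitsOfShape J φ.pullback := φ.preservesCountableColimits J
    infer_instance
  have hnd : ∀ X : Over' B₂, IsNondegenerateObj X → IsNondegenerateObj (F.obj X) := fun X hX =>
    isNondegenerateObj_functor_obj o₁ (hφ _ (isNondegenerateObj_functor_obj o₂.symm hX))
  -- the engine
  obtain ⟨f, ⟨θ⟩⟩ := hE c₁.isTempered c₂.isTempered hB₁ b₂ F hlim hcolim hnd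
  -- ψ := B^temp(f) transported along the charts
  obtain ⟨hres₁, hres₂⟩ := ResIsTemperoidHom_holds c₁.G c₂.G c₁.isTempered c₂.isTempered f
  let Ψ : T₂ ⥤ T₁ := e₂.functor ⋙ BTemp.res f ⋙ e₁.inverse
  haveI := hres₁
  have hΨlim : PreservesFiniteLimits Ψ := by
    haveI : PreservesFiniteLimits (BTemp.res f ⋙ e₁.inverse) := comp_preservesFiniteLimits _ _
    exact comp_preservesFiniteLimits _ _
  have hΨcolim : ∀ (J : Type) [SmallCategory J] [CountableCategory J], PreservesColimitsOfShape J Ψ := by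
    intro J _ _
    haveI : PreservesColimitsOfShape J (BTemp.res f) := hres₂ J
    infer_instance
  refine ⟨⟨Ψ, hΨlim, hΨcolim⟩, ⟨?_⟩⟩
  -- the 1-commutation: λ₂ ⋙ ψ^* ≅ φ^* ⋙ λ₁
  -- (a) `λ₂ ⋙ e₂ = o₂ ⋙ λ_{B₂}` and `λ₁ ⋙ e₁ = o₁ ⋙ λ_{B₁}` (definitional: `liftCompιIso`)
  have i₂ : (admitsHomTo A₂).ι ⋙ e₂.functor ≅ o₂.functor ⋙ (admitsHomTo B₂).ι := Iso.refl _
  have i₁ : (admitsHomTo A₁).ι ⋙ e₁.functor ≅ o₁.functor ⋙ (admitsHomTo B₁).ι := Iso.refl _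
  -- (b) assemble
  symm
  calc (admitsHomTo A₂).ι ⋙ Ψ
      ≅ ((admitsHomTo A₂).ι ⋙ e₂.functor) ⋙ BTemp.res f ⋙ e₁.inverse := Iso.refl _
    _ ≅ (o₂.functor ⋙ (admitsHomTo B₂).ι) ⋙ BTemp.res f ⋙ e₁.inverse := Functor.isoWhiskerRight i₂ _
    _ ≅ o₂.functor ⋙ ((admitsHomTo B₂).ι ⋙ BTemp.res f) ⋙ e₁.inverse := Iso.refl _
    _ ≅ o₂.functor ⋙ (F ⋙ (admitsHomTo B₁).ι) ⋙ e₁.inverse :=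
        Functor.isoWhiskerLeft o₂.functor (Functor.isoWhiskerRight θ.symm e₁.inverse)
    _ ≅ (o₂.functor ⋙ o₂.inverse) ⋙ φ.pullback ⋙ (o₁.functor ⋙ (admitsHomTo B₁).ι) ⋙ e₁.inverse :=
        Iso.refl _
    _ ≅ 𝟭 _ ⋙ φ.pullback ⋙ (o₁.functor ⋙ (admitsHomTo B₁).ι) ⋙ e₁.inverse :=
        Functor.isoWhiskerRight o₂.unitIso.symm _
    _ ≅ φ.pullback ⋙ ((admitsHomTo A₁).ι ⋙ e₁.functor) ⋙ e₁.inverse :=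
        Functor.isoWhiskerLeft φ.pullback (Functor.isoWhiskerRight i₁.symm e₁.inverse)
    _ ≅ φ.pullback ⋙ (admitsHomTo A₁).ι ⋙ (e₁.functor ⋙ e₁.inverse) := Iso.refl _
    _ ≅ φ.pullback ⋙ (admitsHomTo A₁).ι ⋙ 𝟭 _ :=
        Functor.isoWhiskerLeft φ.pullback (Functor.isoWhiskerLeft _ e₁.unitIso.symm)
    _ ≅ φ.pullback ⋙ (admitsHomTo A₁).ι := Iso.refl _

/-- **Thm. A.4 for Galois-countable charts, from the engine** (existence: `thmA4_exists_of_engine`;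
uniqueness: `thmA4_unique`, p414142): the `ThmA4`-shaped statement (QuasiTemperoidsQDPairs) under the
additional hypothesis that the connected temperoids `Tᵢ` admit charts `Tᵢ ≌ B^temp(Πᵢ)` with `Πᵢ` second
countable ([IUTchI] Rmk. 2.5.3 (ii) (E7): Galois-countable), CONDITIONAL on the engine conclusion `hE`
(rows C-S1a/b/c). It does NOT close the typed `ThmA4`, which carries no countability hypothesis.
[cite: MochizukiSemiAnbd2006, Thm A.4 pp.82-86] -/
theorem thmA4_of_engine
    (hE : ∀ {G₁ : Type u} [Group G₁] [TopologicalSpace G₁] [IsTopologicalGroup G₁]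
      [SecondCountableTopology G₁]
      {G₂ : Type u} [Group G₂] [TopologicalSpace G₂] [IsTopologicalGroup G₂]
      [SecondCountableTopology G₂] (_ : IsTempered G₁) (_ : IsTempered G₂)
      {A₁ : BTemp G₁} (_ : IsConnectedObj A₁) {A₂ : BTemp G₂} (_ : A₂.obj.V)
      (F : Over' A₂ ⥤ Over' A₁) (_ : PreservesFiniteLimits F)
      (_ : ∀ (J : Type) [SmallCategory J] [CountableCategory J], PreservesColimitsOfShape J F)
      (_ : ∀ X : Over' A₂, IsNondegenerateObj X → IsNondegenerateObj (F.obj X)),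
      ∃ φ : G₁ →ₜ* G₂, Nonempty (F ⋙ (admitsHomTo A₁).ι ≅ (admitsHomTo A₂).ι ⋙ BTemp.res φ))
    {T₁ : Type u₁} [Category.{v₁} T₁] {T₂ : Type u₂} [Category.{v₂} T₂]
    (c₁ : ConnectedTemperoidChart.{v₁, u, u₁} T₁) (c₂ : ConnectedTemperoidChart.{v₂, u, u₂} T₂)
    [SecondCountableTopology c₁.G] [SecondCountableTopology c₂.G]
    {A₁ : T₁} {A₂ : T₂} (hA₁ : IsConnectedObj A₁) (hA₂ : IsConnectedObj A₂)
    (φ : TemperoidHom (Over' A₁) (Over' A₂)) (hφ : φ.PreservesNondegenerate) :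
    ∃ (ψ : TemperoidHom T₁ T₂)
      (α : φ.pullback ⋙ (admitsHomTo A₁).ι ≅ (admitsHomTo A₂).ι ⋙ ψ.pullback),
      ∀ (ψ' : TemperoidHom T₁ T₂)
        (α' : φ.pullback ⋙ (admitsHomTo A₁).ι ≅ (admitsHomTo A₂).ι ⋙ ψ'.pullback),
        ∃! β : ψ.pullback ≅ ψ'.pullback, α ≪≫ (admitsHomTo A₂).ι.isoWhiskerLeft β = α' := by
  obtain ⟨ψ, ⟨α⟩⟩ := thmA4_exists_of_engine hE c₁ c₂ hA₁ hA₂ φ hφ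
  exact ⟨ψ, α, fun ψ' α' => thmA4_unique ⟨c₂⟩ hA₂ φ ψ ψ' α α'⟩

end ThmA4Chart

end Literature.AnabelianGeometry.SemiGraphs
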